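import Mathlib.Analysis.SpecialFunctions.Integrals.Basic
import Mathlib.MeasureTheory.Integral.Prod
import Literature.MathematicalPhysics.KineticTheory.HardSphereBBGKYLiouvilleFlow
import HarnessLib

/-!
# Local (finite-range) forecast correctors for hard-sphere systems

Definition request `defn-LocalForecastCorrector` of route `AntiMazurCoboundaries` (summit
`AtomisticToContinuum`, sub-problem `HydrodynamicLimit`; informal crux *CollisionTreeCorrectors*,
support *BodyOrderCertifiability*): the phase functions

* `localForecast Ψ R T f z i = ∫₀ᵀ (1 − t/T) f(ζ^{(i,R)}_t(z)) dt` — the **local forecast** of a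
  one-body observable `f : X × ℝ^d → ℝ` for particle `i`: starting from the configuration `z` of
  `N` hard spheres, ONLY the particles within range `R` of particle `i` (the *range cluster*
  `rangeCluster G R z i`: minimal-image distance `‖G.sepVec x_i x_j‖ ≤ R` on the torus) are
  evolved, under their ISOLATED hard-sphere dynamics `Ψ k` (`k` = cluster size; Alexander's flow of
  the sub-cluster, every other particle being ignored); `ζ^{(i,R)}_t(z)` is the resulting state of
  particle `i` at time `t` (`localClusterState`), and `f` is integrated along it against the Fejér
  weight `1 − t/T` on the horizon `[0, T]`;
* `localForecastCorrector Ψ R T f z = − ∑_i localForecast Ψ R T f z i` — the **local forecast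
  corrector** `W_{R,T}` of the one-body observable `F(z) = ∑_i f(z_i)`: the finite-range surrogate
  of the Fejér corrector `−∫₀ᵀ (1 − t/T) F(Φ_t z) dt` of the full flow `Φ` (whose derivative along
  the flow is `F − T⁻¹∫₀ᵀ F∘Φ_t dt`), each particle being forecast by its own range-`R` cluster.

Both are bounded (`abs_localForecast_le`, `abs_localForecastCorrector_le`: `|W| ≤ N·(T/2)·C` when
`|f| ≤ C`, `0 ≤ T`), `R`-local (`localForecast_congr`) and measurable in `z` (`measurable_localForecast`,
`measurable_localForecastCorrector`, torus versions `…_torus` with no extra hypothesis).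

## Design choices

* The sub-cluster dynamics is a PARAMETER `Ψ : (k : ℕ) → HardSphereFlow G ε k` (same diameter
  `ε`, every particle number), exactly as the ambient flow is a parameter of the route statements
  (`HardSphereFlow` is a hypothesis structure; `HardSphereFlow.nonempty_torus_holds` inhabits it on
  `T^d` for `0 < ε < 1/2`, and two flows agree Liouville-a.e.).
* Off the good set of `Ψ k` the flow is junk; we use the jointly measurable device
  `good.piecewise (Ψ k).flow_t id` of `HardSphereFlow.measurable_piecewise_flow` (documented junk
  value: the cluster is frozen, `clusterStateIn_of_not_mem_good`). Nothing changes on the good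
  set (`clusterStateIn_of_mem_good`) and the corrector is measurable on the whole phase space.
* The cluster of `i` always contains `i` (`self_mem_rangeCluster`); particles are relabelled
  increasingly (`Finset.orderIsoOfFin`), the label of `i` being `clusterIndex`; `Config.restrictTo`
  KEEPS a set of particles (the tree's `KineticTheory.removeConfig` deletes one).
* `∫₀ᵀ` is Mathlib's interval integral (`T = 0` gives `0`; `localForecast_const`: `f ≡ c` gives
  `c T/2`).

Not here: estimates of the defect `F − D_W` or of the cost of `W` (route items), the choice of
`Ψ`, finite speed of influence, infinite-volume dynamics, and the regularity of `s ↦ W(Φ_s z)`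
along the FULL flow asked for by the route (with the sharp range cutoff the cluster of `i`, hence
its forecast, may jump when a particle crosses the sphere of radius `R` about `x_i`; a smoothly
weighted cluster would be needed for a Lipschitz statement).

## References

Folklore constructions (finite-range isolated dynamics; Fejér-weighted time averages as approximate
solutions of the Poisson equation `−L W = F`, cf. the resolvent method of Kipnis–Varadhan 1986 and
Kipnis–Landim, *Scaling Limits of Interacting Particle Systems* (1999)); hard-sphere vocabulary of
`HardSpherePhaseSpace` / `HardSphereDynamics` (Gallagher–Saint-Raymond–Texier 2013,
Cercignani–Illner–Pulvirenti 1994, Alexander 1975).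
-/

open MeasureTheory Set
open scoped Topology Interval

namespace Literature.Analysis.FluidPDE

noncomputable section

section Kinetic

variable {d : Type*} {X : Type*} {N : ℕ}

/-! ## Restriction of a configuration to a set of particles; range clusters -/

/-- The restriction of a configuration of `N` particles to a set `S` of particles, relabelled
increasingly by `Fin S.card` (`Finset.orderEmbOfFin`): a configuration of `S.card` particles. [folklore] -/
def Config.restrictTo (S : Finset (Fin N)) (z : Config N d X) : Config S.card d X :=
  fun m => z (S.orderEmbOfFin rfl m)

/-- Unfolding lemma for `Config.restrictTo`. [folklore] -/
@[simp]
theorem Config.restrictTo_apply (S : Finset (Fin N)) (z : Config N d X) (m : Fin S.card) :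
    Config.restrictTo S z m = z (S.orderEmbOfFin rfl m) := rfl

/-- The label in `Fin S.card` of a particle `i ∈ S` after the increasing relabelling of `S`. [folklore] -/
def clusterIndex (S : Finset (Fin N)) (i : Fin N) (hi : i ∈ S) : Fin S.card :=
  (S.orderIsoOfFin rfl).symm ⟨i, hi⟩

/-- The relabelling sends the label of `i` back to `i`. [folklore] -/
@[simp]
theorem orderEmbOfFin_clusterIndex (S : Finset (Fin N)) (i : Fin N) (hi : i ∈ S) :
    S.orderEmbOfFin rfl (clusterIndex S i hi) = i := by
  rw [clusterIndex, ← Finset.coe_orderIsoOfFin_apply, OrderIso.apply_symm_apply]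

/-- The restricted configuration, read at the label of `i`, is the state of particle `i`. [folklore] -/
@[simp]
theorem Config.restrictTo_clusterIndex (S : Finset (Fin N)) (z : Config N d X) (i : Fin N)
    (hi : i ∈ S) : Config.restrictTo S z (clusterIndex S i hi) = z i := by
  rw [Config.restrictTo_apply, orderEmbOfFin_clusterIndex]

/-- Two configurations that agree on `S` have the same restriction to `S`. [folklore] -/
theorem Config.restrictTo_congr {S : Finset (Fin N)} {z z' : Config N d X}
    (h : ∀ j ∈ S, z j = z' j) : Config.restrictTo S z = Config.restrictTo S z' :=
  funext fun m => h _ (S.orderEmbOfFin_mem rfl m)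

/-- Restriction to a set of particles is measurable. [folklore] -/
theorem Config.measurable_restrictTo [MeasurableSpace X] (S : Finset (Fin N)) :
    Measurable (Config.restrictTo (d := d) (X := X) S) :=
  measurable_pi_lambda _ fun _ => measurable_pi_apply _

variable [Fintype d]

open scoped Classical in
/-- The **range cluster** of particle `i` in the configuration `z`: the particles `j` within range
`R` of `i`, `‖G.sepVec x_i x_j‖ ≤ R` (on the flat torus this is the minimal-image Euclidean
distance `Torus.euclidDist x_i x_j ≤ R`, `mem_rangeCluster_torus`), together with `i` itself. [folklore] -/
def rangeCluster (G : Geometry d X) (R : ℝ) (z : Config N d X) (i : Fin N) : Finset (Fin N) :=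
  Finset.univ.filter fun j => j = i ∨ ‖G.sepVec (z i).1 (z j).1‖ ≤ R

/-- Membership in the range cluster. [folklore] -/
theorem mem_rangeCluster {G : Geometry d X} {R : ℝ} {z : Config N d X} {i j : Fin N} :
    j ∈ rangeCluster G R z i ↔ j = i ∨ ‖G.sepVec (z i).1 (z j).1‖ ≤ R := by
  classical
  simp [rangeCluster]

/-- A particle belongs to its own range cluster. [folklore] -/
theorem self_mem_rangeCluster (G : Geometry d X) (R : ℝ) (z : Config N d X) (i : Fin N) :
    i ∈ rangeCluster G R z i :=
  mem_rangeCluster.2 (Or.inl rfl)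

/-- On the flat torus the range cluster of `i` consists of `i` and the particles at minimal-image
distance at most `R` from `x_i`. [folklore] -/
theorem mem_rangeCluster_torus {R : ℝ} {z : Config N d (UnitAddTorus d)} {i j : Fin N} :
    j ∈ rangeCluster (Torus.geometry d) R z i ↔ j = i ∨ Torus.euclidDist (z i).1 (z j).1 ≤ R := by
  rw [mem_rangeCluster, Torus.norm_geometry_sepVec]

/-- The level sets of the range cluster of `i` are measurable sets of configurations, as soon as
the separation map is jointly measurable (`Torus.measurable_geometry_sepVec`,
`Euclidean.measurable_geometry_sepVec`). [folklore] -/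
theorem measurableSet_rangeCluster_eq [MeasurableSpace X] (G : Geometry d X)
    (hG : Measurable fun p : X × X => G.sepVec p.1 p.2) (R : ℝ) (i : Fin N) (S : Finset (Fin N)) :
    MeasurableSet {z : Config N d X | rangeCluster G R z i = S} := by
  let A : Fin N → Set (Config N d X) := fun j => {z | j = i ∨ ‖G.sepVec (z i).1 (z j).1‖ ≤ R}
  have hA : ∀ j, MeasurableSet (A j) := fun j =>
    (MeasurableSet.const (j = i)).union (measurableSet_le
      (hG.comp ((measurable_pi_apply i).fst.prodMk (measurable_pi_apply j).fst)).norm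
      measurable_const)
  have hset : {z : Config N d X | rangeCluster G R z i = S} =
      ⋂ j, if j ∈ S then A j else (A j)ᶜ := by
    ext z
    simp only [Set.mem_setOf_eq, Set.mem_iInter, Finset.ext_iff, mem_rangeCluster]
    refine forall_congr' fun j => ?_
    split_ifs with hj <;> simp [hj, A]
  rw [hset]
  exact MeasurableSet.iInter fun j => by split_ifs; exacts [hA j, (hA j).compl]

/-- A map defined by cases on the value of an auxiliary map `g` with countably many values and
measurable level sets is measurable if every branch is. [folklore] -/
theorem measurable_of_countable_cases {α β γ : Type*} [MeasurableSpace α] [MeasurableSpace γ]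
    [Countable β] (g : α → β) (hg : ∀ b, MeasurableSet (g ⁻¹' {b})) (F : β → α → γ)
    (hF : ∀ b, Measurable (F b)) : Measurable fun a => F (g a) a := by
  intro U hU
  have : (fun a => F (g a) a) ⁻¹' U = ⋃ b, g ⁻¹' {b} ∩ F b ⁻¹' U := by
    ext a
    simp
  rw [this]
  exact MeasurableSet.iUnion fun b => (hg b).inter (hF b hU)

/-! ## The isolated dynamics of a cluster -/

variable [MeasureSpace X] [TopologicalSpace X] {G : Geometry d X} {ε : ℝ}

open scoped Classical in
/-- The state at time `t` of the particle labelled `m` when the particles of `S` are evolved ALONE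
under the hard-sphere flow `Ψ S.card` of `S.card` spheres (the other particles of `z` being
ignored); off the good set of `Ψ S.card` the cluster is frozen (the jointly measurable piecewise
flow of `HardSphereFlow.measurable_piecewise_flow`). [folklore] -/
def clusterStateIn (Ψ : (k : ℕ) → HardSphereFlow G ε k) (S : Finset (Fin N)) (m : Fin S.card)
    (t : ℝ) (z : Config N d X) : X × EuclideanSpace ℝ d :=
  (Ψ S.card).good.piecewise ((Ψ S.card).flow t) id (Config.restrictTo S z) m

/-- On the good set of the cluster flow, `clusterStateIn` is the isolated hard-sphere evolution of
the restricted configuration. [folklore] -/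
theorem clusterStateIn_of_mem_good (Ψ : (k : ℕ) → HardSphereFlow G ε k) {S : Finset (Fin N)}
    (m : Fin S.card) (t : ℝ) {z : Config N d X} (hz : Config.restrictTo S z ∈ (Ψ S.card).good) :
    clusterStateIn Ψ S m t z = (Ψ S.card).flow t (Config.restrictTo S z) m := by
  classical
  simp only [clusterStateIn, Set.piecewise_eq_of_mem _ _ _ hz]

/-- Off the good set of the cluster flow the cluster is frozen (documented junk value). [folklore] -/
theorem clusterStateIn_of_not_mem_good (Ψ : (k : ℕ) → HardSphereFlow G ε k) {S : Finset (Fin N)}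
    (m : Fin S.card) (t : ℝ) {z : Config N d X} (hz : Config.restrictTo S z ∉ (Ψ S.card).good) :
    clusterStateIn Ψ S m t z = z (S.orderEmbOfFin rfl m) := by
  classical
  simp only [clusterStateIn, Set.piecewise_eq_of_notMem _ _ _ hz, id, Config.restrictTo_apply]

/-- `clusterStateIn` only depends on the states of the particles of `S`. [folklore] -/
theorem clusterStateIn_congr (Ψ : (k : ℕ) → HardSphereFlow G ε k) {S : Finset (Fin N)}
    (m : Fin S.card) (t : ℝ) {z z' : Config N d X} (h : ∀ j ∈ S, z j = z' j) :
    clusterStateIn Ψ S m t z = clusterStateIn Ψ S m t z' := by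
  simp only [clusterStateIn, Config.restrictTo_congr h]

/-- The **local cluster state** `ζ^{(i,R)}_t(z)`: the state of particle `i` at time `t` when only
the particles of its range cluster `rangeCluster G R z i` are evolved, under their isolated
hard-sphere dynamics `Ψ k` (`k` the cluster size). [folklore] -/
def localClusterState (Ψ : (k : ℕ) → HardSphereFlow G ε k) (R : ℝ) (t : ℝ) (z : Config N d X)
    (i : Fin N) : X × EuclideanSpace ℝ d :=
  clusterStateIn Ψ (rangeCluster G R z i)
    (clusterIndex (rangeCluster G R z i) i (self_mem_rangeCluster G R z i)) t z

/-- At time `0` the local cluster state of `i` is its actual state (when the restricted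
configuration is a good datum of the cluster flow). [folklore] -/
theorem localClusterState_zero (Ψ : (k : ℕ) → HardSphereFlow G ε k) (R : ℝ) {z : Config N d X}
    {i : Fin N}
    (hz : Config.restrictTo (rangeCluster G R z i) z ∈ (Ψ (rangeCluster G R z i).card).good) :
    localClusterState Ψ R 0 z i = z i := by
  rw [localClusterState, clusterStateIn_of_mem_good Ψ _ _ hz, (Ψ _).flow_zero _ hz,
    Config.restrictTo_clusterIndex]

/-- **`R`-locality of the cluster state**: if `z` and `z'` give particle `i` the same range cluster
and agree on it, the local cluster states of `i` coincide at all times. [folklore] -/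
theorem localClusterState_congr (Ψ : (k : ℕ) → HardSphereFlow G ε k) {R : ℝ} {z z' : Config N d X}
    {i : Fin N} (hS : rangeCluster G R z i = rangeCluster G R z' i)
    (h : ∀ j ∈ rangeCluster G R z i, z j = z' j) (t : ℝ) :
    localClusterState Ψ R t z i = localClusterState Ψ R t z' i := by
  have key : ∀ (S₁ S₂ : Finset (Fin N)) (h₁ : i ∈ S₁) (h₂ : i ∈ S₂), S₁ = S₂ →
      clusterStateIn Ψ S₁ (clusterIndex S₁ i h₁) t z' =
        clusterStateIn Ψ S₂ (clusterIndex S₂ i h₂) t z' := by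
    rintro S₁ S₂ h₁ h₂ rfl
    rfl
  rw [localClusterState, clusterStateIn_congr Ψ _ t h, localClusterState]
  exact key _ _ _ _ hS

/-! ## Local forecasts and the local forecast corrector -/

/-- The **local forecast** of the one-body observable `f` for particle `i`, range `R`, horizon `T`:
`∫₀ᵀ (1 − t/T) f(ζ^{(i,R)}_t(z)) dt`, the Fejér-weighted integral of `f` along the state of `i`
under the isolated dynamics of its range cluster. [folklore] -/
def localForecast (Ψ : (k : ℕ) → HardSphereFlow G ε k) (R T : ℝ)
    (f : X × EuclideanSpace ℝ d → ℝ) (z : Config N d X) (i : Fin N) : ℝ :=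
  ∫ t in (0 : ℝ)..T, (1 - t / T) * f (localClusterState Ψ R t z i)

/-- The **local forecast corrector** `W_{R,T}(z) = −∑_i ∫₀ᵀ (1 − t/T) f(ζ^{(i,R)}_t(z)) dt` of the
one-body observable `F(z) = ∑_i f(z_i)`: the range-`R`, horizon-`T` surrogate of the Fejér
corrector `−∫₀ᵀ (1 − t/T) F(Φ_t z) dt`, each particle being forecast by the isolated dynamics of
its own range cluster. [folklore] -/
def localForecastCorrector (Ψ : (k : ℕ) → HardSphereFlow G ε k) (R T : ℝ)
    (f : X × EuclideanSpace ℝ d → ℝ) (z : Config N d X) : ℝ :=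
  -∑ i, localForecast Ψ R T f z i

/-- **`R`-locality**: the local forecast of particle `i` only depends on its range cluster and on
the states of the particles in it. [folklore] -/
theorem localForecast_congr (Ψ : (k : ℕ) → HardSphereFlow G ε k) {R : ℝ} (T : ℝ)
    (f : X × EuclideanSpace ℝ d → ℝ) {z z' : Config N d X} {i : Fin N}
    (hS : rangeCluster G R z i = rangeCluster G R z' i)
    (h : ∀ j ∈ rangeCluster G R z i, z j = z' j) :
    localForecast Ψ R T f z i = localForecast Ψ R T f z' i := by
  simp only [localForecast, localClusterState_congr Ψ hS h]

/-- The Fejér weight integrates to `T/2` over the horizon. [folklore] -/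
theorem integral_fejerWeight (T : ℝ) : ∫ t in (0 : ℝ)..T, (1 - t / T) = T / 2 := by
  rw [intervalIntegral.integral_sub intervalIntegrable_const
      (intervalIntegral.intervalIntegrable_id.div_const T),
    intervalIntegral.integral_const, intervalIntegral.integral_div, integral_id]
  rcases eq_or_ne T 0 with rfl | hT
  · simp
  · field_simp
    ring

/-- For a constant one-body observable `f ≡ c` the local forecast is `c T / 2` (the cluster
dynamics is invisible and the Fejér weight integrates to `T/2`), so that
`W_{R,T} = −N c T/2`. [folklore] -/
theorem localForecast_const (Ψ : (k : ℕ) → HardSphereFlow G ε k) (R T c : ℝ) (z : Config N d X)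
    (i : Fin N) : localForecast Ψ R T (fun _ => c) z i = c * (T / 2) := by
  simp only [localForecast]
  rw [intervalIntegral.integral_mul_const, integral_fejerWeight, mul_comm]

/-- **Boundedness of the local forecast**: `|∫₀ᵀ (1 − t/T) f(…) dt| ≤ (T/2)·C` when `|f| ≤ C`
and `0 ≤ T` (the Fejér weight is nonnegative on `[0, T]` and integrates to `T/2`). [folklore] -/
theorem abs_localForecast_le (Ψ : (k : ℕ) → HardSphereFlow G ε k) (R : ℝ) {T : ℝ} (hT : 0 ≤ T)
    {f : X × EuclideanSpace ℝ d → ℝ} {C : ℝ} (hf : ∀ q, |f q| ≤ C) (z : Config N d X) (i : Fin N) :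
    |localForecast Ψ R T f z i| ≤ T / 2 * C := by
  have hw : ∀ᵐ t ∂(volume : Measure ℝ), t ∈ Set.Ioc 0 T →
      ‖(1 - t / T) * f (localClusterState Ψ R t z i)‖ ≤ (1 - t / T) * C :=
    Filter.Eventually.of_forall fun t ht => by
      have h0 : 0 ≤ 1 - t / T := sub_nonneg.2 (div_le_one_of_le₀ ht.2 hT)
      rw [norm_mul, Real.norm_eq_abs, Real.norm_eq_abs, abs_of_nonneg h0]
      exact mul_le_mul_of_nonneg_left (hf _) h0
  have h := intervalIntegral.norm_integral_le_of_norm_le hT hw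
    ((intervalIntegrable_const.sub (intervalIntegral.intervalIntegrable_id.div_const T)).mul_const C)
  rw [intervalIntegral.integral_mul_const, integral_fejerWeight] at h
  simpa [localForecast, Real.norm_eq_abs] using h

/-- **Boundedness of the local forecast corrector**: `|W_{R,T}| ≤ N · (T/2) · C` when `|f| ≤ C`
and `0 ≤ T`. [folklore] -/
theorem abs_localForecastCorrector_le (Ψ : (k : ℕ) → HardSphereFlow G ε k) (R : ℝ) {T : ℝ}
    (hT : 0 ≤ T) {f : X × EuclideanSpace ℝ d → ℝ} {C : ℝ} (hf : ∀ q, |f q| ≤ C)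
    (z : Config N d X) : |localForecastCorrector Ψ R T f z| ≤ N * (T / 2 * C) := by
  rw [localForecastCorrector, abs_neg]
  calc |∑ i, localForecast Ψ R T f z i| ≤ ∑ i, |localForecast Ψ R T f z i| :=
        Finset.abs_sum_le_sum_abs _ _
    _ ≤ ∑ _i : Fin N, T / 2 * C := Finset.sum_le_sum fun i _ => abs_localForecast_le Ψ R hT hf z i
    _ = N * (T / 2 * C) := by simp

/-! ## Measurability -/

variable [BorelSpace X] [SecondCountableTopology X] [TopologicalSpace.PseudoMetrizableSpace X]

/-- Joint measurability of the isolated cluster evolution in `(t, z)` (from the joint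
measurability of the piecewise hard-sphere flow, for a geometry with continuous translations). [folklore] -/
theorem measurable_clusterStateIn (Ψ : (k : ℕ) → HardSphereFlow G ε k)
    (hG : ∀ x : X, Continuous (G.translate x)) (S : Finset (Fin N)) (m : Fin S.card) :
    Measurable fun p : ℝ × Config N d X => clusterStateIn Ψ S m p.1 p.2 := by
  unfold clusterStateIn
  exact (measurable_pi_apply m).comp ((Ψ S.card).measurable_piecewise_flow_comp hG measurable_fst
    ((Config.measurable_restrictTo S).comp measurable_snd))

/-- Joint measurability of the local cluster state `(t, z) ↦ ζ^{(i,R)}_t(z)` (cases on the value of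
the range cluster, `measurableSet_rangeCluster_eq`, `measurable_clusterStateIn`). [folklore] -/
theorem measurable_localClusterState (Ψ : (k : ℕ) → HardSphereFlow G ε k)
    (hG : ∀ x : X, Continuous (G.translate x))
    (hG' : Measurable fun p : X × X => G.sepVec p.1 p.2) (R : ℝ) (i : Fin N) :
    Measurable fun p : ℝ × Config N d X => localClusterState Ψ R p.1 p.2 i := by
  let F : Finset (Fin N) → ℝ × Config N d X → X × EuclideanSpace ℝ d := fun S p =>
    if hi : i ∈ S then clusterStateIn Ψ S (clusterIndex S i hi) p.1 p.2 else p.2 i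
  have hF : ∀ S, Measurable (F S) := by
    intro S
    by_cases hi : i ∈ S
    · simp only [F, dif_pos hi]
      exact measurable_clusterStateIn Ψ hG S _
    · simp only [F, dif_neg hi]
      exact (measurable_pi_apply i).comp measurable_snd
  have hg : ∀ S, MeasurableSet ((fun p : ℝ × Config N d X => rangeCluster G R p.2 i) ⁻¹' {S}) :=
    fun S => measurable_snd (measurableSet_rangeCluster_eq G hG' R i S)
  have heq : (fun p : ℝ × Config N d X => localClusterState Ψ R p.1 p.2 i) =
      fun p => F (rangeCluster G R p.2 i) p := by
    funext p
    simp only [F, dif_pos (self_mem_rangeCluster G R p.2 i)]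
    rfl
  rw [heq]
  exact measurable_of_countable_cases _ hg F hF

/-- **Measurability of the local forecast** in the configuration, for a measurable one-body
observable (joint measurability of the integrand in `(t, z)` and measurability of parametric
Bochner integrals, `MeasureTheory.StronglyMeasurable.integral_prod_left`). [folklore] -/
theorem measurable_localForecast (Ψ : (k : ℕ) → HardSphereFlow G ε k)
    (hG : ∀ x : X, Continuous (G.translate x))
    (hG' : Measurable fun p : X × X => G.sepVec p.1 p.2) (R T : ℝ)
    {f : X × EuclideanSpace ℝ d → ℝ} (hf : Measurable f) (i : Fin N) :
    Measurable fun z : Config N d X => localForecast Ψ R T f z i := by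
  have hI : Measurable (Function.uncurry fun (t : ℝ) (z : Config N d X) =>
      (1 - t / T) * f (localClusterState Ψ R t z i)) :=
    (measurable_const.sub (measurable_fst.div_const T)).mul
      (hf.comp (measurable_localClusterState Ψ hG hG' R i))
  have h : ∀ μ : Measure ℝ, SFinite μ → Measurable fun z : Config N d X =>
      ∫ t, (1 - t / T) * f (localClusterState Ψ R t z i) ∂μ := fun μ _ =>
    (hI.stronglyMeasurable.integral_prod_left (μ := μ)).measurable
  simp only [localForecast, intervalIntegral]
  exact (h _ inferInstance).sub (h _ inferInstance)

/-- **Measurability of the local forecast corrector** `W_{R,T}` on the whole phase space. [folklore] -/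
theorem measurable_localForecastCorrector (Ψ : (k : ℕ) → HardSphereFlow G ε k)
    (hG : ∀ x : X, Continuous (G.translate x))
    (hG' : Measurable fun p : X × X => G.sepVec p.1 p.2) (R T : ℝ)
    {f : X × EuclideanSpace ℝ d → ℝ} (hf : Measurable f) :
    Measurable (localForecastCorrector Ψ R T f : Config N d X → ℝ) := by
  unfold localForecastCorrector
  exact (Finset.measurable_sum _ fun i _ => measurable_localForecast Ψ hG hG' R T hf i).neg

end Kinetic

/-! ## The torus case -/

section Torus

variable {d : Type*} [Fintype d] {N : ℕ} {ε : ℝ}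

/-- On the flat torus the local forecast of a measurable one-body observable is measurable in the
configuration, with no further hypothesis (`Torus.continuous_geometry_translate`,
`Torus.measurable_geometry_sepVec`). [folklore] -/
theorem measurable_localForecast_torus (Ψ : (k : ℕ) → HardSphereFlow (Torus.geometry d) ε k)
    (R T : ℝ) {f : UnitAddTorus d × EuclideanSpace ℝ d → ℝ} (hf : Measurable f) (i : Fin N) :
    Measurable fun z : Config N d (UnitAddTorus d) => localForecast Ψ R T f z i :=
  measurable_localForecast Ψ Torus.continuous_geometry_translate Torus.measurable_geometry_sepVec
    R T hf i

/-- On the flat torus the local forecast corrector `W_{R,T}` of a measurable one-body observable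
is a measurable phase function. [folklore] -/
theorem measurable_localForecastCorrector_torus
    (Ψ : (k : ℕ) → HardSphereFlow (Torus.geometry d) ε k) (R T : ℝ)
    {f : UnitAddTorus d × EuclideanSpace ℝ d → ℝ} (hf : Measurable f) :
    Measurable (localForecastCorrector Ψ R T f : Config N d (UnitAddTorus d) → ℝ) :=
  measurable_localForecastCorrector Ψ Torus.continuous_geometry_translate
    Torus.measurable_geometry_sepVec R T hf

end Torus

end

end Literature.Analysis.FluidPDE
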